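import Literature.AlgebraicGeometry.Deformation.DefectCochain
import Literature.AlgebraicGeometry.Modules.CechEndCochainDifferential
import HarnessLib

/-!
# The obstruction Čech `2`-cocycle of a framed module across a thickening

Setting as in `Deformation/DefectCochain.lean`: `j : Y ⟶ Z₀`, `i : Z₀ ⟶ Z₁`,
`eI : i_* j_* 𝒪_Y ≅ 𝓘 = Ker(i♯)`, an `𝒪_{Z₀}`-module `F` with a frame cover `C = (U_a, I_a, e_a)`
over opens of `Z₁`, a system of lifts `L = (T̃_{ab})` of its transition matrices, `E = j^*F` with its
base framing `𝔣 = C.baseFraming j` on `Y`, and the defect `2`-cochain `κ(c)` (`L.defectCochain eI`).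

* `D₂_defectCochain` — the twisted matrix differential of the defect cochain VANISHES (the twisted
  cocycle identity `kdefAt_cocycle`, restricted to the opens of `Y`);
* `obsCocycle eI L : E ⟶ Č²(𝓤^Y, E)` — **the obstruction cocycle**: the Čech `2`-cochain of
  `𝓔nd(E)` with matrices `κ(c_{abd})` (`Framing.toEnd 2`), a COCYCLE of the Čech complex of `E`
  (`obsCocycle_comp_d`, `obsCocycle_comp_complex_d`);
* `defectCochain_sub` / `obsCocycle_sub` — **change of lifts changes the cocycle by a coboundary**:
  `κ(c') - κ(c) = D₁ κ(H)` and `obsCocycle L' - obsCocycle L = toEnd 1 κ(H) ≫ d` (first-order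
  thickening).

This is the cocycle `{g̃_{αβ} g̃_{βγ} g̃_{γα} - 1}` of Hartshorne, *Deformation Theory*, Thm. 7.1 (c)
("the obstruction to lifting `ℱ` … lies in `H²(X₀, 𝓔nd ℱ₀ ⊗ J)`"), realised as a morphism into the
Čech resolution of `E` — the form in which it defines a class in Mathlib's `Ext²(E, E)` through the
iterated connecting classes (`Literature/Algebra/Homology/IteratedExtClass.lean`). Everything is
proved; no named facts.

## References

* R. Hartshorne, *Deformation Theory*, GTM 257 (2010), §7, Thm. 7.1 and its proof. [Hartshorne2010]
* The Stacks Project, Tag 08L8. [StacksProject]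
-/

noncomputable section

open CategoryTheory AlgebraicGeometry Opposite TopologicalSpace Limits

namespace Literature.AlgebraicGeometry.Deformation

open Literature.AlgebraicGeometry.Modules Literature.AlgebraicGeometry.Motives

universe u

variable {Y Z₀ Z₁ : Scheme.{u}} {j : Y ⟶ Z₀} {i : Z₀ ⟶ Z₁} {F : Z₀.Modules} {ι : Type u}

namespace FrameCover.Lifts

variable {C : FrameCover i F ι}
  (eI : (Scheme.Modules.pushforward i).obj ((Scheme.Modules.pushforward j).obj (unitModule Y)) ≅
    idealModule i)
  (L L' : C.Lifts)

/-! ### Reading the cochains over a common open of `Z₁` -/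

/-- The defect cochain over `V ≤ j⁻¹i⁻¹W` is the restriction of `κ(c)` over `W`, for any
`W ≤ U_{α₀} ∩ U_{α₁} ∩ U_{α₂}`. [folklore] -/
lemma defectCochain_mat_eq (α : Fin 3 → ι) (V : Y.Opens) (hV : ∀ k, V ≤ (C.baseFraming j).U (α k))
    (W : Z₁.Opens) (h0 : W ≤ C.U (α 0)) (h1 : W ≤ C.U (α 1)) (h2 : W ≤ C.U (α (Fin.last 2)))
    (hVW : V ≤ baseOpen j i W) :
    (L.defectCochain eI).mat α V hV =
      (L.kdefAt eI (α 0) (α 1) (α (Fin.last 2)) W h0 h1 h2).map (secRes Y hVW) := by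
  rw [defectCochain_mat, ← L.kdefAt_map eI (α 0) (α 1) (α (Fin.last 2)) (inf_le_left.trans inf_le_left)
    (inf_le_left.trans inf_le_right) inf_le_right (le_inf (le_inf h0 h1) h2), Matrix.map_map]
  congr 1
  funext x
  exact (secRes_secRes _ _ _).symm

/-- The change-of-lifts cochain over `V ≤ j⁻¹i⁻¹W` is the restriction of `κ(H)` over `W`. [folklore] -/
lemma diffCochain_mat_eq (α : Fin 2 → ι) (V : Y.Opens) (hV : ∀ k, V ≤ (C.baseFraming j).U (α k))
    (W : Z₁.Opens) (h0 : W ≤ C.U (α 0)) (h1 : W ≤ C.U (α (Fin.last 1))) (hVW : V ≤ baseOpen j i W) :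
    (diffCochain eI L L').mat α V hV =
      (kdiffAt eI L L' (α 0) (α (Fin.last 1)) W h0 h1).map (secRes Y hVW) := by
  rw [diffCochain_mat, ← kdiffAt_map eI L L' (α 0) (α (Fin.last 1)) inf_le_left inf_le_right (le_inf h0 h1),
    Matrix.map_map]
  congr 1
  funext x
  exact (secRes_secRes _ _ _).symm

/-- The transition matrices of the base framing over `V ≤ j⁻¹i⁻¹W` are the restrictions of
`T̄ = red(T̃)` over `W`. [folklore] -/
lemma T_eq_map_TY (a b : ι) (V : Y.Opens) (ha : V ≤ (C.baseFraming j).U a) (hb : V ≤ (C.baseFraming j).U b)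
    (W : Z₁.Opens) (haW : W ≤ C.U a) (hbW : W ≤ C.U b) (hVW : V ≤ baseOpen j i W) :
    (C.baseFraming j).T a b V ha hb = (L.TY a b W haW hbW).map (secRes Y hVW) :=
  ((C.baseFraming j).T_map a b _ _ hVW).symm.trans
    (congrArg (fun M => M.map (secRes Y hVW)) (C.T_baseFraming L a b W haW hbW))

/-! ### The defect cochain is a twisted cocycle -/

/-- **`D₂ κ(c) = 0`**: the twisted matrix differential of the defect cochain vanishes.
[cite: Hartshorne2010, §7 (proof of Thm. 7.1)] -/
theorem D₂_defectCochain : (C.baseFraming j).D₂ (L.defectCochain eI) = 0 := by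
  refine Framing.Cochain.ext fun β V hV => ?_
  rw [Framing.Cochain.zero_mat, Framing.D₂_mat]
  -- read everything over `W = U_{β₀} ∩ U_{β₁} ∩ U_{β₂} ∩ U_{β₃}`
  set W : Z₁.Opens := C.U (β 0) ⊓ C.U (β 1) ⊓ C.U (β 2) ⊓ C.U (β (Fin.last 3)) with hW
  have h0 : W ≤ C.U (β 0) := inf_le_left.trans (inf_le_left.trans inf_le_left)
  have h1 : W ≤ C.U (β 1) := inf_le_left.trans (inf_le_left.trans inf_le_right)
  have h2 : W ≤ C.U (β 2) := inf_le_left.trans inf_le_right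
  have h3 : W ≤ C.U (β (Fin.last 3)) := inf_le_right
  have hVW : V ≤ baseOpen j i W := le_inf (le_inf (le_inf (hV 0) (hV 1)) (hV 2)) (hV (Fin.last 3))
  rw [show (L.defectCochain eI).tet0 β V hV = (L.kdefAt eI (β 1) (β 2) (β (Fin.last 3)) W h1 h2 h3).map
        (secRes Y hVW) from L.defectCochain_mat_eq eI _ V _ W h1 h2 h3 hVW,
    show (L.defectCochain eI).tet1 β V hV = (L.kdefAt eI (β 0) (β 2) (β (Fin.last 3)) W h0 h2 h3).map
        (secRes Y hVW) from L.defectCochain_mat_eq eI _ V _ W h0 h2 h3 hVW,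
    show (L.defectCochain eI).tet2 β V hV = (L.kdefAt eI (β 0) (β 1) (β (Fin.last 3)) W h0 h1 h3).map
        (secRes Y hVW) from L.defectCochain_mat_eq eI _ V _ W h0 h1 h3 hVW,
    show (L.defectCochain eI).tet3 β V hV = (L.kdefAt eI (β 0) (β 1) (β 2) W h0 h1 h2).map
        (secRes Y hVW) from L.defectCochain_mat_eq eI _ V _ W h0 h1 h2 hVW,
    L.T_eq_map_TY (β 0) (β 1) V (hV 0) (hV 1) W h0 h1 hVW,
    L.T_eq_map_TY (β 2) (β (Fin.last 3)) V (hV 2) (hV (Fin.last 3)) W h2 h3 hVW,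
    ← Matrix.map_mul, ← Matrix.map_mul, ← Matrix.map_sub (secRes Y hVW) (map_sub _),
    ← Matrix.map_add (secRes Y hVW) (map_add _), ← Matrix.map_sub (secRes Y hVW) (map_sub _)]
  exact (congrArg (fun M => M.map (secRes Y hVW))
    (L.kdefAt_cocycle eI (β 0) (β 1) (β 2) (β (Fin.last 3)) W h0 h1 h2 h3)).trans
    (Matrix.map_zero _ (map_zero _))

/-! ### Change of lifts -/

/-- **Change of lifts, as cochains**: `κ(c') - κ(c) = D₁ κ(H)` on a first-order thickening.
[cite: Hartshorne2010, §7 (proof of Thm. 7.1)] -/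
theorem defectCochain_sub [IsFirstOrderThickening i] :
    L'.defectCochain eI - L.defectCochain eI = (C.baseFraming j).D₁ (diffCochain eI L L') := by
  refine Framing.Cochain.ext fun α V hV => ?_
  rw [Framing.Cochain.sub_mat, Framing.D₁_mat]
  set W : Z₁.Opens := C.U (α 0) ⊓ C.U (α 1) ⊓ C.U (α (Fin.last 2)) with hW
  have h0 : W ≤ C.U (α 0) := inf_le_left.trans inf_le_left
  have h1 : W ≤ C.U (α 1) := inf_le_left.trans inf_le_right
  have h2 : W ≤ C.U (α (Fin.last 2)) := inf_le_right
  have hVW : V ≤ baseOpen j i W := le_inf (le_inf (hV 0) (hV 1)) (hV (Fin.last 2))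
  rw [L'.defectCochain_mat_eq eI α V hV W h0 h1 h2 hVW, L.defectCochain_mat_eq eI α V hV W h0 h1 h2 hVW,
    show (diffCochain eI L L').tri0 α V hV = (kdiffAt eI L L' (α 1) (α (Fin.last 2)) W h1 h2).map
        (secRes Y hVW) from diffCochain_mat_eq eI L L' _ V _ W h1 h2 hVW,
    show (diffCochain eI L L').tri1 α V hV = (kdiffAt eI L L' (α 0) (α (Fin.last 2)) W h0 h2).map
        (secRes Y hVW) from diffCochain_mat_eq eI L L' _ V _ W h0 h2 hVW,
    show (diffCochain eI L L').tri2 α V hV = (kdiffAt eI L L' (α 0) (α 1) W h0 h1).map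
        (secRes Y hVW) from diffCochain_mat_eq eI L L' _ V _ W h0 h1 hVW,
    L.T_eq_map_TY (α 0) (α 1) V (hV 0) (hV 1) W h0 h1 hVW,
    L.T_eq_map_TY (α 1) (α (Fin.last 2)) V (hV 1) (hV (Fin.last 2)) W h1 h2 hVW,
    ← Matrix.map_mul, ← Matrix.map_mul, ← Matrix.map_sub (secRes Y hVW) (map_sub _),
    ← Matrix.map_sub (secRes Y hVW) (map_sub _), ← Matrix.map_add (secRes Y hVW) (map_add _)]
  exact congrArg (fun M => M.map (secRes Y hVW))
    ((L.kdefAt_sub_kdefAt eI L' (α 0) (α 1) (α (Fin.last 2)) W h0 h1 h2).trans (add_sub_right_comm _ _ _))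

/-! ### The obstruction cocycle -/

/-- **The obstruction cocycle `E ⟶ Č²(𝓤^Y, E)` of the framed module with respect to the lifts `L`**:
the Čech `2`-cochain of `𝓔nd(E)`, `E = j^*F`, whose matrix on the simplex `(a, b, d)` is
`κ(T̃_{ab} T̃_{bd} - T̃_{ad})` (from the frame `e_d` to the frame `e_a`).
[cite: Hartshorne2010, §7 (Thm. 7.1 (c) and its proof)] -/
def obsCocycle : (Scheme.Modules.pullback j).obj F ⟶
    Cech.obj (C.baseFraming j).U 2 ((Scheme.Modules.pullback j).obj F) :=
  (C.baseFraming j).toEnd 2 (L.defectCochain eI)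

/-- **The obstruction cocycle is a Čech cocycle**: `obsCocycle ≫ d = 0`.
[cite: Hartshorne2010, §7 (proof of Thm. 7.1)] -/
theorem obsCocycle_comp_d : L.obsCocycle eI ≫ Cech.d (C.baseFraming j).U _ 2 = 0 :=
  (C.baseFraming j).toEnd_comp_d_two_eq_zero _ (L.D₂_defectCochain eI)

/-- The obstruction cocycle is a `2`-cocycle of the Čech COMPLEX of `E` (the form consumed by
`ExactAugmentation.theta`). [folklore] -/
theorem obsCocycle_comp_complex_d :
    L.obsCocycle eI ≫ (Cech.complex (C.baseFraming j).U ((Scheme.Modules.pullback j).obj F)).d 2 3 = 0 :=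
  (C.baseFraming j).toEnd_comp_complex_d_eq_zero _ (L.D₂_defectCochain eI)

/-- **A change of lifts changes the obstruction cocycle by a Čech coboundary**:
`obsCocycle L' - obsCocycle L = toEnd 1 κ(H) ≫ d`. [cite: Hartshorne2010, §7 (proof of Thm. 7.1)] -/
theorem obsCocycle_sub [IsFirstOrderThickening i] :
    L'.obsCocycle eI - L.obsCocycle eI =
      (C.baseFraming j).toEnd 1 (diffCochain eI L L') ≫ Cech.d (C.baseFraming j).U _ 1 := by
  rw [obsCocycle, obsCocycle, ← Framing.toEnd_sub, defectCochain_sub, Framing.toEnd_D₁_eq_comp_d]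

/-- The same with the differential of the Čech complex. [folklore] -/
theorem obsCocycle_sub_complex [IsFirstOrderThickening i] :
    L'.obsCocycle eI - L.obsCocycle eI =
      (C.baseFraming j).toEnd 1 (diffCochain eI L L') ≫
        (Cech.complex (C.baseFraming j).U ((Scheme.Modules.pullback j).obj F)).d 1 2 := by
  rw [Cech.complex_d]
  exact obsCocycle_sub eI L L'

end FrameCover.Lifts

end Literature.AlgebraicGeometry.Deformation

end
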